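import Literature.NumberTheory.GaloisRepresentations.InducedGaloisRep
import Literature.NumberTheory.GaloisRepresentations.FramedRepTwist
import HarnessLib

/-!
# An induced representation is stable under twisting by characters trivial on the subgroup
# (`Ind_H^G ρ ⊗ η ≅ Ind_H^G ρ` for `η|_H = 1`)

Topic `Literature/NumberTheory/GaloisRepresentations`.  Theorem-only file (no named fact, no new
notion).  The elementary half of Mackey/Clifford theory for monomial representations: if
`η : G → Aˣ` is a character which is trivial on `φ(H)` (for `[G : φ(H)] = 2` this is the quadratic
character cutting out `H`), then `Ind_H^G(ρ) ⊗ η = Ind_H^G(ρ ⊗ η|_H) = Ind_H^G(ρ)` up to an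
EXPLICIT change of frame: in the matrix form of `Ind` (`InducedGaloisRep`: blocks
`ρ̇(rᵢ⁻¹ g rⱼ)` for a transversal `rᵢ`) the twist by `η` is conjugation by the diagonal matrix
with entries `η(rᵢ)` on block `i` (`FramedRep.induce_twist_eq_conj`, explicit; 
`FramedGaloisRep.induce_twist_eq_conj`, `∃ D`, with the trace / characteristic-polynomial corollaries).  This is the self-twist `I ≅ I ⊗ η_{F/K}` of a twisted
induction `I = Ind_{Γ_F}^{Γ_K} ρ` from which automorphic-induction descents start (Arthur–Clozel:
a cuspidal `Π` with `Π ≅ Π ⊗ η` is automorphically induced).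

Proof: block `(i, j)` of `Ind(ρ)(g)` vanishes unless `rᵢ⁻¹ g rⱼ = φ(h)`, and then
`η(g) = η(rᵢ) η(φ h) η(rⱼ)⁻¹ = η(rᵢ) η(rⱼ)⁻¹`, which is the effect of `D Ind(ρ)(g) D⁻¹` on that
block for `D = diag(η(rᵢ))`.

## References

* J.-P. Serre, *Linear representations of finite groups*, GTM 42 (1977), §3.3 (matrix form of
  `Ind`), §7.3 (Mackey). [SerreLinearRepresentations1977]
* J. Arthur, L. Clozel, *Simple algebras, base change, and the advanced theory of the trace
  formula*, Ann. of Math. Stud. 120 (1989), Ch. 3 §6 (automorphic induction and self-twists).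
  [ArthurClozelAMS120]
-/

noncomputable section

open Matrix Field Topology

namespace Literature.NumberTheory.GaloisRepresentations

universe u v

section Framed

variable {H : Type*} {G : Type*} [Group H] [TopologicalSpace H] [Group G] [TopologicalSpace G]
  [IsTopologicalGroup G] {A : Type*} [CommRing A] [TopologicalSpace A] [IsTopologicalRing A]
  {n m : ℕ} {ι : Type*} [Fintype ι] [DecidableEq ι]

namespace FramedRep

/-- **`Ind(ρ) ⊗ η = D Ind(ρ) D⁻¹` for a character `η` of `G` trivial on `φ(H)`**, with the
explicit diagonal `D = diag(η(rᵢ))` (entry `η(rᵢ)` at every index of block `i`): twisting an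
induced framed representation by a character that dies on the inducing subgroup is a change of
frame. [folklore] -/
theorem induce_twist_eq_conj {φ : H →* G} (hφ : IsOpenEmbedding φ) {r : ι → G}
    (hr : Function.Bijective fun i => (r i : G ⧸ φ.range)) (e : ι × Fin n ≃ Fin m)
    (ρ : FramedRep H A n) (η : G →ₜ* Aˣ) (hη : ∀ h : H, η (φ h) = 1) :
    ∃ D : GL (Fin m) A,
      (D : Matrix (Fin m) (Fin m) A) = Matrix.diagonal (fun x => ((η (r (e.symm x).1) : Aˣ) : A)) ∧
      (induce φ hφ r hr e ρ).twist η = (induce φ hφ r hr e ρ).conj D := by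
  -- the diagonal frame and its inverse
  let D : GL (Fin m) A :=
    { val := Matrix.diagonal fun x => ((η (r (e.symm x).1) : Aˣ) : A)
      inv := Matrix.diagonal fun x => (((η (r (e.symm x).1))⁻¹ : Aˣ) : A)
      val_inv := by
        rw [Matrix.diagonal_mul_diagonal, ← Matrix.diagonal_one]
        congr 1
        funext x
        rw [Units.mul_inv]
      inv_val := by
        rw [Matrix.diagonal_mul_diagonal, ← Matrix.diagonal_one]
        congr 1
        funext x
        rw [Units.inv_mul] }
  have hD : ((D : GL (Fin m) A) : Matrix (Fin m) (Fin m) A) =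
      Matrix.diagonal fun x => ((η (r (e.symm x).1) : Aˣ) : A) := rfl
  have hDinv : (((D⁻¹ : GL (Fin m) A)) : Matrix (Fin m) (Fin m) A) =
      Matrix.diagonal fun x => (((η (r (e.symm x).1))⁻¹ : Aˣ) : A) := rfl
  refine ⟨D, hD, ContinuousMonoidHom.ext fun g => Units.ext ?_⟩
  rw [coe_twist_apply, conj_apply, Units.val_mul, Units.val_mul, hD, hDinv, induce_apply_coe]
  ext x y
  rw [Matrix.smul_apply, mul_diagonal, diagonal_mul, indFlatHom_apply]
  set i := (e.symm x).1
  set j := (e.symm y).1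
  by_cases hmem : (r i)⁻¹ * g * r j ∈ φ.range
  · obtain ⟨h, hh⟩ := hmem
    -- `η g = η(rᵢ) η(φ h) η(rⱼ)⁻¹ = η(rᵢ) η(rⱼ)⁻¹`
    have hg : g = r i * φ h * (r j)⁻¹ := by rw [hh]; group
    have hηg : (η g : A) = (η (r i) : A) * ((η (r j))⁻¹ : Aˣ) := by
      rw [hg, map_mul, map_mul, hη, mul_one, map_inv, Units.val_mul]
    rw [hηg, smul_eq_mul]
    ring
  · rw [dotExtend_of_not_mem _ _ hmem]
    simp

end FramedRep

end Framed

/-! ### Galois representations: `Ind_{Γ_F}^{Γ_K} ρ ⊗ η = D Ind_{Γ_F}^{Γ_K} ρ D⁻¹` for `η|_{Γ_F} = 1` -/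

section Galois

variable (K : Type u) {F : Type v} [Field K] [Field F] [Algebra K F] [CharZero K]
  [FiniteDimensional K F] {A : Type*} [CommRing A] [TopologicalSpace A] [IsTopologicalRing A]
  {n d : ℕ}

namespace FramedGaloisRep

/-- **Self-twist of an induced Galois representation.**  For a finite extension `F/K` of fields
of characteristic `0` of degree `d`, `ρ : Γ_F →ₜ* GL_n(A)` and a continuous character
`η : Γ_K →ₜ* Aˣ` trivial on `res(Γ_F)` (e.g. for `[F : K] = 2`, the quadratic character of `F/K`),
`Ind_{Γ_F}^{Γ_K}(ρ) ⊗ η` is a conjugate of `Ind_{Γ_F}^{Γ_K}(ρ)` (by the explicit diagonal frame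
`diag(η(rᵢ))` built from the transversal of `induce`) — in particular the two framed
representations are isomorphic and have the same traces and characteristic polynomials.
[folklore] -/
theorem induce_twist_eq_conj (hd : Module.finrank K F = d) (ρ : FramedGaloisRep F A n)
    (η : absoluteGaloisGroup K →ₜ* Aˣ) (hη : ∀ σ : absoluteGaloisGroup F, η (absGaloisRestrict K F σ) = 1) :
    ∃ D : GL (Fin (d * n)) A, (ρ.induce K hd).twist η = (ρ.induce K hd).conj D := by
  obtain ⟨D, -, hD⟩ := FramedRep.induce_twist_eq_conj (isOpenEmbedding_absGaloisRestrict K F)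
    (absGaloisCosetRep_bijective K F hd) finProdFinEquiv ρ η hη
  exact ⟨D, by rw [induce_def]; exact hD⟩

/-- Consequently the twist has the same trace function. [folklore] -/
theorem trace_induce_twist_eq (hd : Module.finrank K F = d) (ρ : FramedGaloisRep F A n)
    (η : absoluteGaloisGroup K →ₜ* Aˣ) (hη : ∀ σ : absoluteGaloisGroup F, η (absGaloisRestrict K F σ) = 1)
    (g : absoluteGaloisGroup K) :
    FramedRep.trace ((ρ.induce K hd).twist η) g = FramedRep.trace (ρ.induce K hd) g := by
  obtain ⟨D, hD⟩ := induce_twist_eq_conj K hd ρ η hη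
  rw [hD, FramedRep.trace, FramedRep.trace, FramedRep.conj_apply, Units.val_mul, Units.val_mul,
    Matrix.trace_mul_cycle, Units.inv_mul, Matrix.one_mul]

/-- And the same characteristic polynomials. [folklore] -/
theorem charpoly_induce_twist_eq (hd : Module.finrank K F = d) (ρ : FramedGaloisRep F A n)
    (η : absoluteGaloisGroup K →ₜ* Aˣ) (hη : ∀ σ : absoluteGaloisGroup F, η (absGaloisRestrict K F σ) = 1)
    (g : absoluteGaloisGroup K) :
    FramedRep.charpoly ((ρ.induce K hd).twist η) g = FramedRep.charpoly (ρ.induce K hd) g := by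
  obtain ⟨D, hD⟩ := induce_twist_eq_conj K hd ρ η hη
  rw [hD, FramedRep.charpoly, FramedRep.charpoly, FramedRep.conj_apply, Units.val_mul, Units.val_mul,
    Matrix.coe_units_inv]
  exact Matrix.charpoly_units_conj D _

end FramedGaloisRep

end Galois

end Literature.NumberTheory.GaloisRepresentations

end
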